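import Mathlib.Tactic
import Literature.NumberTheory.EllipticCurves.Rank1Residual.Typed.Basic

/-!
# STUB-IDEAS k1-g14 — `stub_heegnerIndexLowerAtTwo` (crux `SplitBadTwoLowerHalfOfFacts`, item 27851)

Technique (assigned): weaken / strengthen.  Home family 1 (recognise & import).
BSD is NOT proved by any of this; nothing below touches `Theorems/`.

Currency (as in the critic's `StubPlanT3ArmMPrimeS3cExact.lean`):
`A := v₂ #Ш_an(W)`, `B := v₂ #Ш(W)[2^∞]`, `g := v₂ Tam(W) − 2·v₂ #W(ℚ)_tors + 2ℓ_W`,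
`m := v₂ ‖Katz value at ψ*_W‖⁻²` (the LEAD's `m`, `‖val‖ = 2^{-m/2}`), `n :=` the characteristic-series
valuation of S3c (`restrictedControl_two_holds`: `n = B + g + eC(key)`), `eM :=` the T1 constant
(`m ≤ 2n + eM` containment, `2n + eM ≤ m` Euler-system direction), and the DEFINED analytic defect
`eA(X) := m_X − 2(A_X + g_X)` (no S2′ assumed anywhere in §A).

§A  FLOOR THEOREM (weaken axis closed): on an anchored key, LOWER(W) is EQUIVALENT to the relative
    one-sided Rubin floor `eA(W) − eM(W) ≥ eA(W₀) − eM(W₀)`; hence no analytic input strictly weaker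
    than the relative floor can suffice, and the ∃-keyed S2′ (item 23721) exceeds what LOWER needs
    exactly by two-sidedness + key-constancy at non-anchor members (pre-computed repair C′).
§B  STRENGTHEN: explicit constants make LOWER anchor-free on every key (incl. the three anchorless
    keys) iff the budget sign `κ := eA − 2eC − eM ≥ 0` holds; the sign is necessary for the method.
§C  FAMILY-1 RECOGNITION, typed: S2′ is the θ-critical / CM twin of Perrin-Riou's conjecture.
    Road PR/BK: Katz(ψ*_W) ≐ Res(𝓛^cr_Iw) · ∂_σ L_2((f_A ⊗ χ_t)_β, σ)|_{σ=χ_{d₂}} ≐ Res · log(loc₂ BK₁(W))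
    (d = d₂·t, t ≡ 1 (4) the tame part, χ_{d₂} ∈ {χ₋₄, χ₈, χ₋₈}·[shift] the point of 2-adic weight space)
    [Bellaïche, Eigenbook Thm 8.2.5 (8.2.1); LLZ 2013 Thm 3.4; Benois–Büyükboduk arXiv:2403.16076
    §4.3.2–4.3.3], and PR-conj `log BK₁ = −(1−1/α)(1−1/β)·c(f)·log(P)²`, `c(f) = L'(f,1)/(Ω⁺ĥ(P))`
    [BPS arXiv:1811.08216 Thm 1.1.5; BDV].  The ℤ-shadow shows how the four seams compose to the
    S2′ SHAPE `m = 2(A+g) + eA` with `eA` 2-local + archimedean, and which seam carries `Ш_an` (PR₂).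
§D  Real-currency form of the member step against `MissingLowerBoundAt` (tree decl).
-/

namespace Summit.BirchSwinnertonDyer.BirchSwinnertonDyer.Cruxes.SplitBadTwoLowerHalfOfFacts.StubIdeasK1G14

/-! ## §A The floor theorem: LOWER ⟺ relative one-sided Rubin floor (anchored key) -/

section Floor

variable {A B m n g eC eM A₀ B₀ m₀ n₀ g₀ eM₀ : ℤ}

/-- Sufficiency (the arm-M″ direction, one-sided hypotheses only): containment at the member,
Euler-system direction at the anchor, S3c at both (THEOREM `restrictedControl_two_holds`, same `eC`
on one key), `BSD₂(W₀)`, and the RELATIVE FLOOR stated with the *defined* defects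
`eA := m − 2(A+g)`, `eA₀ := m₀ − 2(A₀+g₀)`.  No S2′. -/
theorem lower_of_relFloor
    (hMC : m ≤ 2 * n + eM) (hS3c : n = B + g + eC)
    (hES₀ : 2 * n₀ + eM₀ ≤ m₀) (hS3c₀ : n₀ = B₀ + g₀ + eC) (hBSD₀ : A₀ = B₀)
    (hfloor : (m₀ - 2 * (A₀ + g₀)) - eM₀ ≤ (m - 2 * (A + g)) - eM) :
    A ≤ B := by
  omega

/-- Necessity: with the OPPOSITE halves also available (Euler-system direction at the member —
Müller 2020 Thm 3.21, `μ = 0 ⇒ ε = 0`, used at every member in card k1-g13 PLAN B — and containment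
at the anchor), LOWER(W) forces the relative floor.  So the relative floor is the WEAKEST analytic
input that can close LOWER through T1 ∘ S3c: the weaken axis on HARDEST (a) is exhausted. -/
theorem relFloor_of_lower
    (hES : 2 * n + eM ≤ m) (hS3c : n = B + g + eC)
    (hMC₀ : m₀ ≤ 2 * n₀ + eM₀) (hS3c₀ : n₀ = B₀ + g₀ + eC) (hBSD₀ : A₀ = B₀)
    (hlow : A ≤ B) :
    (m₀ - 2 * (A₀ + g₀)) - eM₀ ≤ (m - 2 * (A + g)) - eM := by
  omega

/-- The exact form under two-sided T1 at both curves: the BSD₂ defect of the member is read off the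
two relative constants, `2(A − B) = (eA₀ − eA) − (eM₀ − eM)`.  (k1-g13's `defect_T1minus_exact` is the
special case `eA ≡ eA₀`, i.e. S2′ assumed; here S2′ is NOT assumed and σ is free.) -/
theorem defect_exact
    (hT1 : m = 2 * n + eM) (hS3c : n = B + g + eC)
    (hT1₀ : m₀ = 2 * n₀ + eM₀) (hS3c₀ : n₀ = B₀ + g₀ + eC) (hBSD₀ : A₀ = B₀) :
    2 * (A - B) = ((m₀ - 2 * (A₀ + g₀)) - (m - 2 * (A + g))) - (eM₀ - eM) := by
  omega

/-- Corollary (σ key-constant, card k3-g13: `eM = eM₀`): LOWER(W) ⟺ `eA(W₀) ≤ eA(W)`. -/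
theorem lower_iff_eA_monotone
    (hT1 : m = 2 * n + eM) (hS3c : n = B + g + eC)
    (hT1₀ : m₀ = 2 * n₀ + eM) (hS3c₀ : n₀ = B₀ + g₀ + eC) (hBSD₀ : A₀ = B₀) :
    A ≤ B ↔ m₀ - 2 * (A₀ + g₀) ≤ m - 2 * (A + g) := by
  omega

/-- Pre-computed REPAIR (planner insurance): if the keyed ∃-form S2′ (23721) were refuted as typed
(say `eA` turned out to depend on a datum beyond the dyadic key), LOWER survives on exactly the
members where the relative floor survives — the floor is the repaired statement C′, member by member. -/
theorem lower_survives_keyed_refutation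
    (hMC : m ≤ 2 * n + eM) (hS3c : n = B + g + eC)
    (hES₀ : 2 * n₀ + eM ≤ m₀) (hS3c₀ : n₀ = B₀ + g₀ + eC) (hBSD₀ : A₀ = B₀)
    (δ : ℤ) (hδ : 0 ≤ δ)                       -- any non-keyed, member-dependent surplus is harmless
    (hfloor : m₀ - 2 * (A₀ + g₀) + δ = m - 2 * (A + g)) :
    A ≤ B := by
  omega

end Floor

/-! ## §B Strengthen: explicit constants ⇒ anchor-free LOWER on every key; the budget sign is necessary -/

section Explicit

variable {A B m n g eC eM eA : ℤ}

/-- Anchor-free member inequality: containment (T1, one-sided), S3c, the one-sided S2′ floor with an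
EXPLICIT `eA`, and the budget sign `κ := eA − 2eC − eM ≥ −1` (odd slack).  With explicit tables for `eA`
(§C predicts its 2-local shape), `eC` (R96: explicit in the S3c proof) and `eM` (k3-g13: σ ≡ 0 plus
the JLK/de Shalit (37) prefactor) this closes LOWER on ALL six keys — including (1,3), (0,3), (0,5),
which the ∃-form can only reach through kit anchors (R92′). -/
theorem lower_of_explicit
    (hMC : m ≤ 2 * n + eM) (hS3c : n = B + g + eC)
    (hS2 : 2 * (A + g) + eA ≤ m) (hκ : 2 * eC + eM ≤ eA + 1) :   -- odd slack: κ ≥ −1 suffices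
    A ≤ B := by
  omega

/-- The budget sign is NECESSARY for the explicit method, sharp up to the odd slack: if `κ ≤ −2` there
is an instance of all three hypotheses with `A > B` (so no explicit-constant bookkeeping closes LOWER
without `κ ≥ −1`; on an anchored key `κ = 0` is exactly what the anchor certifies, cf. `defect_exact`). -/
theorem explicit_needs_kappa (eC eM eA : ℤ) (hκ : eA + 1 < 2 * eC + eM) :   -- κ ≤ −2
    ∃ A B m n g : ℤ, m ≤ 2 * n + eM ∧ n = B + g + eC ∧ 2 * (A + g) + eA ≤ m ∧ B < A := by
  refine ⟨1, 0, 2 * eC + eM, eC, 0, ?_, ?_, ?_, ?_⟩ <;> omega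

end Explicit

/-! ## §C Road PR/BK (Perrin-Riou twin): how the four seams compose to the S2′ shape

Half-free integer bookkeeping of 2-adic valuations:
* `m`  : `v₂‖Katz(ψ*_W)‖⁻²` (LEAD's normalisation, `‖val‖ = 2^{-m/2}`);
* `b`  : `v₂ log_ω(loc₂ BK₁(W))` (Bloch–Kato log of the Beilinson–Kato element);
* `ρ`  : `v₂ Res_{s=0} 𝓛^{cr}_Iw(W)(χ⁻¹⟨χ⟩^{-s})` (Benois–Büyükboduk's Iwasawa-theoretic critical 𝓛-invariant;
  BB Cor. 3.21: for `f = f_A`, `ord_{s=1} L(A,s) = 1`, it is non-zero with a SIMPLE pole at `𝟙`, p odd);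
* `cW` : `v₂ c(f_W)`, `c(f) = L'(W,1)/(Ω_W ĥ(P_W))`, so `cW = A + g − 2ℓ` (definition of `Ш_an`);
* `κ₁ κ₂ κ₃` : valuations of the explicit algebraic factors of the three printed identities
  (2-local interpolation / stabilisation factors of `χ_{d,2}` and archimedean normalisations).
Seams (LEAD normalisation `m = 2·v₂(value)`): BB₂ `m = 2b + 2ρ + κ₁` [arXiv:2403.16076 §4.3.3, eq. (PR ⇒ Rubin):
`L^{Katz}(ψ_*) ≐ Res(𝓛^{cr}_Iw) · L'_{K,β*}(f*,𝟙) ≐ Res(𝓛^{cr}_Iw) · log_{ω_f}(res_p BK₀(f*,𝟙))`, "≐" = up to explicit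
algebraic factors]; PR₂ `b = cW + 2ℓ + κ₂` [BPS arXiv:1811.08216 Thm 1.1.5 shape `log BK₁ = −(1−1/α)(1−1/β)·c(f)·log(P)²`];
L₂ `ρ = κ₃` (the residue's valuation is key-only once PR₂ has absorbed `c(f)·log²P`; at p odd BB prove the simple pole
from Bertrand's non-vanishing of the critical p-adic height — at `p = 2` this is a seam of its own). -/

section RoadPR

variable {A g ℓ m b ρ cW κ₁ κ₂ κ₃ : ℤ}

/-- The four seams compose to the S2′ SHAPE with `eA = 2κ₂ + 2κ₃ + κ₁` — a function of the 2-local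
and archimedean constants only: this is the family-1 EVIDENCE for the LEAD's typing
`eA : (d % 2, d′ % 8) ↦ ℤ` (no odd-prime digit enters any printed instance of the template). -/
theorem S2shape_of_roadPR
    (hBB : m = 2 * b + 2 * ρ + κ₁) (hPR : b = cW + 2 * ℓ + κ₂)
    (hcf : cW = A + g - 2 * ℓ) (hL : ρ = κ₃) :
    m = 2 * (A + g) + (2 * κ₂ + 2 * κ₃ + κ₁) := by
  subst hL; omega

/-- The WEAKEST form of road PR that LOWER needs (by §A): one-sided seams.  PR₂ is needed only as the
divisibility `b ≥ cW + 2ℓ + κ₂` ("BK₁ is at least as 2-divisible in W(ℚ) ⊗ ℤ₂ as c(f)·log²P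
predicts" — the EULER-SYSTEM direction of Perrin-Riou's conjecture) and L₂ only as `ρ ≥ κ₃`. -/
theorem S2floor_of_roadPR_oneSided
    (hBB : m = 2 * b + 2 * ρ + κ₁) (hPR : cW + 2 * ℓ + κ₂ ≤ b)
    (hcf : cW = A + g - 2 * ℓ) (hL : κ₃ ≤ ρ) :
    2 * (A + g) + (2 * κ₂ + 2 * κ₃ + κ₁) ≤ m := by
  omega

/-- Relative form along a same-key pair (W, W₀) (constants `κᵢ` shared): the relative floor of §A
follows from RELATIVE one-sided seams — a relative PR-divisibility `b − b₀ ≥ cW − cW₀ + 2(ℓ − ℓ₀)` and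
a relative residue bound `ρ₀ ≤ ρ`.  (The card explains why the relative PR-divisibility is NOT
reachable without the member's own `L'(W,1)`-formula: no relative Gross–Zagier exists; DLR elliptic
Stark points are conjectural — so road PR is a third road, not a shortcut.) -/
theorem relFloor_of_relRoadPR {A₀ g₀ ℓ₀ m₀ b₀ ρ₀ cW₀ : ℤ}
    (hBB : m = 2 * b + 2 * ρ + κ₁) (hBB₀ : m₀ = 2 * b₀ + 2 * ρ₀ + κ₁)
    (hcf : cW = A + g - 2 * ℓ) (hcf₀ : cW₀ = A₀ + g₀ - 2 * ℓ₀)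
    (hrelPR : (cW - cW₀) + 2 * (ℓ - ℓ₀) ≤ b - b₀) (hrelL : ρ₀ ≤ ρ) :
    m₀ - 2 * (A₀ + g₀) ≤ m - 2 * (A + g) := by
  omega

end RoadPR

/-! ## §D Real-currency form of the member step (tree decl `MissingLowerBoundAt`) -/

section RealCurrency

open Literature.NumberTheory.EllipticCurves Literature.NumberTheory.EllipticCurves.Rank1Residual.Typed

/-- The anchor-free member step of §B in the tree's currency: for a curve `W` with rational `Ш_an`,
any integers `m n ℓ` and constants satisfying containment, S3c (shape of
`PrintCf2.SelmerLocImage.restrictedControl_two_holds`), the explicit one-sided S2′ floor and the budget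
sign give `MissingLowerBoundAt W 2`.  (`shaOrder`, `tamagawaProduct`, `torsionOrder` as in the route.) -/
theorem missingLowerBoundAt_two_of_explicit (W : WeierstrassCurve ℚ)
    (q : ℚ) (hq : shaAn W = (q : ℂ))
    (m n ℓ eC eM eA : ℤ)
    (hMC : m ≤ 2 * n + eM)
    (hS3c : n = ((padicValNat 2 W.shaOrder : ℤ) + (padicValNat 2 W.tamagawaProduct : ℤ)
            - 2 * (padicValNat 2 W.torsionOrder : ℤ) + 2 * ℓ) + eC)
    (hS2 : 2 * (padicValRat 2 q + (padicValNat 2 W.tamagawaProduct : ℤ)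
            - 2 * (padicValNat 2 W.torsionOrder : ℤ) + 2 * ℓ) + eA ≤ m)
    (hκ : 2 * eC + eM ≤ eA) :
    MissingLowerBoundAt W 2 := by
  refine ⟨q, hq, ?_⟩
  omega

/-- The anchored (arm-M″) member step in the tree's currency with the RELATIVE FLOOR of §A as the only
analytic hypothesis (no S2′): anchor `W₀` with `BSD₂(W₀)` in Miller's currency (`MissingPPartAt W₀ 2`). -/
theorem missingLowerBoundAt_two_of_relFloor (W W₀ : WeierstrassCurve ℚ)
    (q : ℚ) (hq : shaAn W = (q : ℂ)) (h₀ : MissingPPartAt W₀ 2)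
    (m n ℓ m₀ n₀ ℓ₀ eC eM eM₀ : ℤ)
    (hMC : m ≤ 2 * n + eM)
    (hS3c : n = ((padicValNat 2 W.shaOrder : ℤ) + (padicValNat 2 W.tamagawaProduct : ℤ)
            - 2 * (padicValNat 2 W.torsionOrder : ℤ) + 2 * ℓ) + eC)
    (hES₀ : 2 * n₀ + eM₀ ≤ m₀)
    (hS3c₀ : n₀ = ((padicValNat 2 W₀.shaOrder : ℤ) + (padicValNat 2 W₀.tamagawaProduct : ℤ)
            - 2 * (padicValNat 2 W₀.torsionOrder : ℤ) + 2 * ℓ₀) + eC)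
    (hfloor : ∀ q₀ : ℚ, shaAn W₀ = (q₀ : ℂ) →
        (m₀ - 2 * (padicValRat 2 q₀ + (padicValNat 2 W₀.tamagawaProduct : ℤ)
            - 2 * (padicValNat 2 W₀.torsionOrder : ℤ) + 2 * ℓ₀)) - eM₀
        ≤ (m - 2 * (padicValRat 2 q + (padicValNat 2 W.tamagawaProduct : ℤ)
            - 2 * (padicValNat 2 W.torsionOrder : ℤ) + 2 * ℓ)) - eM) :
    MissingLowerBoundAt W 2 := by
  obtain ⟨q₀, hq₀, hv₀⟩ := h₀
  have hf := hfloor q₀ hq₀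
  refine ⟨q, hq, ?_⟩
  omega

end RealCurrency

end Summit.BirchSwinnertonDyer.BirchSwinnertonDyer.Cruxes.SplitBadTwoLowerHalfOfFacts.StubIdeasK1G14
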